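import Literature.Computability.Cryptography.ShorAssemblyLeaves
import Literature.Computability.Cryptography.ShorAssemblyProofs
import Literature.Computability.QuantumComplexity.CoinFamilyKernelProofs
import HarnessLib

/-!
# Shor's factoring theorem: closing the two leaves

Topic `Literature/Computability/Cryptography`; proof companion of `ShorAssembly.lean` and
`ShorAssemblyLeaves.lean`. Both leaves of the assembly are now discharged in the tree —
`uniformOracleCoinSimulation_holds` (`QuantumComplexity/CoinFamilyKernelProofs.lean`: the relativised
uniform reversible simulation of a polynomial-time oracle computation on Hadamard coins, Bernstein–
Vazirani 1997, proof of Thm. 8.3 with the oracle track of §8.3) and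
`isQSolvable_of_mem_BQP_oracle_holds` (`ShorAssemblyProofs.lean`: `BQP^BQP = BQP` for extension-closed
search relations, Bennett–Bernstein–Brassard–Vazirani 1997, Cor. 4.15 with Thms. 4.13–4.14) — so the
bridges of `ShorAssemblyLeaves.lean` give, with no further input:

* **`kernelProb_ge_uniformProb_of_mem_FPRel_holds`** — the coin/oracle-simulation fact of
  `ShorAssembly.lean` (Bernstein–Vazirani 1997, Thm. 8.3: "dovetail … with the Fourier transform
  on the second track, giving `Σ_y 2^{-p(n)/2} |x⟩|y⟩`; dovetail with a synchronized normal form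
  version of `M`, giving `Σ_y 2^{-p(n)/2} |x⟩|y⟩|M(x;y)⟩`; observe the third track", p. 1451; queries
  on an oracle track `|x·b⟩ ↦ |x·(b ⊕ f(x))⟩`, §8.3, p. 1455), by
  `kernelProb_ge_uniformProb_of_mem_FPRel_of_sim`;
* `isQSolvable_of_mem_FPRel_BQP_holds` — the classical-base principle of
  `ShorAssemblyClassicalBase.lean`, by `isQSolvable_of_mem_FPRel_BQP_of_leaves`;
* **`isQSolvable_factoring_holds`**, `factoring_mem_FBQP_holds`, `FACT_mem_BQP_holds` — Shor's
  theorem (`Shor.lean`, pqc.S06: both `FBQP` forms and the decision form `FACT ∈ BQP`), by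
  `isQSolvable_factoring_of_leaves`, `factoring_mem_FBQP_of_leaves`, `FACT_mem_BQP_of_leaves`
  (every Shor-specific ingredient — the randomised reduction to order finding, the classical
  programs, Kitaev's order-finding family, its uniformity and analysis, the classical wrapping
  `isQSolvable_classicalWrap_holds` — was already proved there).

No statement is introduced or changed here; the file only applies existing bridges to existing
discharges.

## References

* E. Bernstein, U. Vazirani, *Quantum complexity theory*, SIAM J. Comput. 26 (1997) 1411–1473,
  Thm. 8.3 (`BPP ⊆ BQP`, proof, p. 1451) and §8.3 (oracle quantum Turing machines, p. 1455)
  [BernsteinVazirani1997SICOMP].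
* C. H. Bennett, E. Bernstein, G. Brassard, U. Vazirani, *Strengths and weaknesses of quantum
  computing*, SIAM J. Comput. 26 (1997) 1510–1523, Thm. 4.14 and Cor. 4.15 (`BQP^BQP = BQP`)
  [BennettBernsteinBrassardVazirani1997].
* P. W. Shor, *Polynomial-time algorithms for prime factorization and discrete logarithms on a
  quantum computer*, SIAM J. Comput. 26 (1997) 1484–1509, §5 [Shor1997SICOMP].
-/

namespace Literature.Computability.Cryptography

open QuantumComplexity

/-- **Coins and reversible simulation of polynomial-time oracle computations** (Bernstein–Vazirani
1997, proof of Thm. 8.3 `BPP ⊆ BQP`, relativised through the oracle track of §8.3): the named fact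
`kernelProb_ge_uniformProb_of_mem_FPRel` of `ShorAssembly.lean` holds — for `G ∈ FP^A` and a coin
polynomial `q` there is a poly-time uniform Clifford+T family with oracle gates for `A` with
`Pr_c[G ⟨x, c⟩ ∈ S] ≤ Pr[the output on x has a prefix in S]` for every event `S`. It is the bridge
`kernelProb_ge_uniformProb_of_mem_FPRel_of_sim` (`ShorAssemblyLeaves.lean`, through
`exists_uniform_kernelProb_ge_uniformProb` of `CoinFamilyKernel.lean`: Born rule on the Hadamard
layer) applied to the discharged relativised simulation `uniformOracleCoinSimulation_holds`
(`CoinFamilyKernelProofs.lean`).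
[cite: BernsteinVazirani1997SICOMP, Thm. 8.3 (proof, p. 1451) and §8.3 (oracle QTMs, p. 1455)] -/
theorem kernelProb_ge_uniformProb_of_mem_FPRel_holds : kernelProb_ge_uniformProb_of_mem_FPRel :=
  kernelProb_ge_uniformProb_of_mem_FPRel_of_sim uniformOracleCoinSimulation_holds

/-- **The classical-base principle holds**: `BPP^{BQP}` search problems with an extension-closed
relation and coin success `≥ 3/4` are solvable in bounded-error quantum polynomial time
(`isQSolvable_of_mem_FPRel_BQP`, `ShorAssemblyClassicalBase.lean`), by
`isQSolvable_of_mem_FPRel_BQP_of_leaves` and the two discharged leaves.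
[cite: BennettBernsteinBrassardVazirani1997, Cor. 4.15 (BQP^BQP = BQP) with Thm. 4.14] -/
theorem isQSolvable_of_mem_FPRel_BQP_holds : isQSolvable_of_mem_FPRel_BQP :=
  isQSolvable_of_mem_FPRel_BQP_of_leaves isQSolvable_of_mem_BQP_oracle_holds
    uniformOracleCoinSimulation_holds

/-- **Shor's theorem, FBQP form** (Shor 1997, §5): the prime factorisation
`Nat.primeFactorsList ∘ decodeNat` is computable in bounded-error quantum polynomial time — a
poly-time uniform, oracle-free Clifford+T family outputs, with probability `≥ 2/3`, a string with
prefix the encoding of the list of prime factors (`isQSolvable_factoring`, `Shor.lean`). By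
`isQSolvable_factoring_of_leaves` and the two discharged leaves.
[cite: Shor1997SICOMP, §5 (factoring in quantum polynomial time)] -/
theorem isQSolvable_factoring_holds : isQSolvable_factoring :=
  isQSolvable_factoring_of_leaves isQSolvable_of_mem_BQP_oracle_holds
    uniformOracleCoinSimulation_holds

/-- **Shor's theorem, `FBQP`-membership form** (`factoring_mem_FBQP`, `Shor.lean`).
[cite: Shor1997SICOMP, §5 (factoring in quantum polynomial time)] -/
theorem factoring_mem_FBQP_holds : factoring_mem_FBQP :=
  factoring_mem_FBQP_of_leaves isQSolvable_of_mem_BQP_oracle_holds uniformOracleCoinSimulation_holds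

/-- **Shor's theorem, decision form `FACT ∈ BQP`** (`FACT_mem_BQP`, `Shor.lean`): the language of
pairs `⟨N, k⟩` such that `N` has a divisor `1 < d ≤ k` is in `BQP`. By `FACT_mem_BQP_of_leaves`
and the two discharged leaves. [cite: Shor1997SICOMP, §5 (decision form)] -/
theorem FACT_mem_BQP_holds : FACT_mem_BQP :=
  FACT_mem_BQP_of_leaves isQSolvable_of_mem_BQP_oracle_holds uniformOracleCoinSimulation_holds

end Literature.Computability.Cryptography
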